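import Literature.NumberTheory.Sieve.FouvryTenenbaumLiouvilleProofs
import HarnessLib

/-!
# Bombieri–Vinogradov for `λ` in reduced classes with one height per modulus

Topic `Literature/NumberTheory/Sieve`; everything in this file is PROVED (theorems only).  Companion of
`FouvryTenenbaumLiouvilleProofs.lean` (Fouvry–Tenenbaum 2021, Theorem 1.8 for `f = λ` at a FIXED height `x`):
here the same Bombieri–Vinogradov theorem for the Liouville function is proved with an arbitrary integer
height `N_q ≤ X` per modulus, which is the form consumed by applications with varying ranges
(Iwaniec–Kowalski, Theorem 17.4, is stated with `max_{y ≤ x}`).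

* `bv_liouvilleAP`: `∑_{q ≤ Q} |∑_{m ≤ N_q, m ≡ a_q (q)} λ(m)| ≤ C X/(log X)^A` for `Q ≤ X^{1/2}/(log X)^B`,
  integer heights `N_q ≤ X` and units `a_q`, from the tree's Bombieri–Vinogradov theorem for `μ` with
  per-modulus heights (`Literature.NumberTheory.Sieve.bombieriVinogradov_moebius`) and the Siegel–Walfisz
  bound for `∑_{m ≤ t, (m,q)=1} μ(m)` (`Literature.NumberTheory.Sieve.Polymath8a.sum_moebius_coprime_progression_le_uniform`
  with `SiegelWalfiszMoebius_holds`) through `λ = 𝟙_□ ⋆ μ`: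
  `∑_{m ≤ N, m ≡ a (q)} λ(m) = ∑_{k² ≤ N, (k,q)=1} M_μ(N/k²; q, a k̄²)`, `M_μ = Δ_μ + φ(q)⁻¹ ∑_{(m,q)=1} μ`,
  squares `k ≤ (log X)^{A+2}` by the two theorems, larger squares trivially.
* `term_le`: a term `|∑_{n ≤ y/d} λ(dn + c)|` (`0 ≤ c < d`, `g = (c, d)`) is at most the `λ`-sum over the
  REDUCED class `c/g (mod d/g)` up to the height `(d/g)⌊y/d⌋ + c/g`, plus `1` (complete multiplicativity) — the
  reduction of an arbitrary residue to a reduced one.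

Consumer: the support item `BVLiouville` of route `Summits/Parity/GeneralizedHardyLittlewood/Theses/
LiouvilleShiftedTables.lean` (= stub `stub_bvLiouville` of the crux `TypeI2Dilated`, line `peel-to-drappeau`).

## References

* H. Iwaniec, E. Kowalski, *Analytic Number Theory*, AMS 2004, Theorem 17.4. [IwaniecKowalski2004]
* É. Fouvry, G. Tenenbaum, Trans. Amer. Math. Soc. 375 (2022), Theorem 1.8. [FouvryTenenbaum2021]
-/

open Finset Real

noncomputable section

namespace Literature.NumberTheory.Sieve.BVLiouvilleHeights

open ArithmeticFunction Literature.NumberTheory.Sieve Literature.NumberTheory.Sieve.BVMoebius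
open scoped ArithmeticFunction.Moebius
open Literature.NumberTheory.Sieve.FTLiouville (inner_progression_eq card_filter_natCast_eq_le)
open Literature.NumberTheory.LFunctions (SiegelWalfiszMoebius_holds)
open Literature.NumberTheory.LFunctions.SiegelWalfiszLiouville (sum_liouville_progression_eq
  filter_isSquare_Ioc_eq_image sum_Ioc_inv_sq_le)
open Literature.NumberTheory.LFunctions.LiouvilleSum (abs_liouville_le_one)

/-! ### `λ`-sums in a reduced class as Möbius sums over the squares -/

/-- `|∑_{m ≤ N, m ≡ a (q)} λ(m)| ≤ ∑_{k ≤ √N} |M_μ(N/k²; q, a k̄²)|` for a unit `a` (`λ = 𝟙_□ ⋆ μ`; the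
squares not coprime to `q` contribute nothing, the junk residue only enlarges the bound). [folklore] -/
theorem abs_liouvilleAP_le_sum_sq {q : ℕ} {a : ZMod q} (ha : IsUnit a) (N : ℕ) :
    |∑ m ∈ (Icc 1 N).filter (fun m : ℕ => (m : ZMod q) = a), (liouville m : ℝ)| ≤
      ∑ k ∈ Ioc 0 (Nat.sqrt N), |moebiusAPSum (N / (k * k)) q (sqResidue q a (k * k))| := by
  set D : ℕ → ℝ := fun s => if s.Coprime q then moebiusAPSum (N / s) q (a * ((s : ZMod q))⁻¹) else 0
    with hD
  have h1 : ∑ m ∈ (Icc 1 N).filter (fun m : ℕ => (m : ZMod q) = a), (liouville m : ℝ) =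
      ∑ s ∈ Ioc 0 N, (if IsSquare s then (1 : ℝ) else 0) * D s := by
    rw [sum_liouville_progression_eq a N]
    exact sum_congr rfl fun s _ => by rw [inner_progression_eq ha]
  have h2 : ∑ s ∈ Ioc 0 N, |(if IsSquare s then (1 : ℝ) else 0) * D s| =
      ∑ s ∈ (Ioc 0 N).filter IsSquare, |D s| := by
    rw [sum_filter]
    exact sum_congr rfl fun s _ => by split_ifs <;> simp
  rw [h1]
  refine (abs_sum_le_sum_abs _ _).trans ?_
  rw [h2, filter_isSquare_Ioc_eq_image, sum_image fun k₁ _ k₂ _ h => Nat.mul_self_inj.1 h]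
  refine sum_le_sum fun k _ => ?_
  simp only [hD, sqResidue]
  split_ifs
  · exact le_rfl
  · rw [abs_zero]; exact abs_nonneg _

/-- The trivial bound `|M_μ(M; q, b)| ≤ M/q + 1`. [folklore] -/
theorem abs_moebiusAPSum_le (M q : ℕ) (b : ZMod q) : |moebiusAPSum M q b| ≤ (M : ℝ) / q + 1 := by
  unfold moebiusAPSum
  refine (abs_sum_le_sum_abs _ _).trans ?_
  calc ∑ m ∈ (Icc 1 M).filter (fun m : ℕ => (m : ZMod q) = b), |(μ m : ℝ)|
      ≤ ∑ _m ∈ (Icc 1 M).filter (fun m : ℕ => (m : ZMod q) = b), (1 : ℝ) :=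
        sum_le_sum fun m _ => by exact_mod_cast abs_moebius_le_one
    _ = #((Icc 1 M).filter (fun m : ℕ => (m : ZMod q) = b)) := by simp
    _ ≤ ((M / q + 1 : ℕ) : ℝ) := by exact_mod_cast card_filter_natCast_eq_le b M
    _ ≤ (M : ℝ) / q + 1 := by push_cast; gcongr; exact Nat.cast_div_le

/-- `|M_μ(M; q, b)| ≤ |Δ_μ(M; q, b)| + φ(q)⁻¹ |∑_{m ≤ M, (m,q)=1} μ(m)|`. [folklore] -/
theorem abs_moebiusAPSum_le_disc (M q : ℕ) (b : ZMod q) :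
    |moebiusAPSum M q b| ≤
      |moebiusDisc M q b| + ((Nat.totient q : ℝ))⁻¹ * |moebiusCoprimeSum M q| := by
  have h : moebiusAPSum M q b =
      moebiusDisc M q b + ((Nat.totient q : ℝ))⁻¹ * moebiusCoprimeSum M q := by
    unfold moebiusDisc; ring
  have hφ : (0 : ℝ) ≤ ((Nat.totient q : ℝ))⁻¹ := inv_nonneg.2 (Nat.cast_nonneg _)
  calc |moebiusAPSum M q b|
      = |moebiusDisc M q b + ((Nat.totient q : ℝ))⁻¹ * moebiusCoprimeSum M q| := by rw [← h]
    _ ≤ |moebiusDisc M q b| + |((Nat.totient q : ℝ))⁻¹ * moebiusCoprimeSum M q| := abs_add_le _ _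
    _ = _ := by rw [abs_mul, abs_of_nonneg hφ]

/-! ### Bombieri–Vinogradov for `λ` in reduced classes, one height per modulus -/

set_option maxHeartbeats 1600000 in
/-- **Bombieri–Vinogradov for `λ` in progressions, reduced residues, one integer height per modulus**:
for `A > 0` there are `B > 0`, `C ≥ 0`, `x₀` with
`∑_{q ≤ Q} |∑_{m ≤ N_q, m ≡ a_q (q)} λ(m)| ≤ C X/(log X)^A` whenever `X ≥ x₀`, `Q ≤ X^{1/2}/(log X)^B`,
`N_q ≤ X` and the `a_q` are units.  From `bombieriVinogradov_moebius` and the Siegel–Walfisz bound for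
`∑_{(m,q)=1} μ(m)` through `λ = 𝟙_□ ⋆ μ` (squares `k ≤ (log X)^{A+2}` by these, larger squares
trivially). [cite: IwaniecKowalski2004, Theorem 17.4] -/
theorem bv_liouvilleAP (A : ℝ) (hA : 0 < A) :
    ∃ B C x₀ : ℝ, 0 < B ∧ 0 ≤ C ∧ ∀ X : ℝ, x₀ ≤ X →
      ∀ Q : ℕ, (Q : ℝ) ≤ X ^ (1 / 2 : ℝ) / Real.log X ^ B →
      ∀ N : ℕ → ℕ, (∀ q, (N q : ℝ) ≤ X) →
      ∀ a : (q : ℕ) → ZMod q, (∀ q ∈ Icc 1 Q, IsUnit (a q)) →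
        ∑ q ∈ Icc 1 Q, |∑ m ∈ (Icc 1 (N q)).filter (fun m : ℕ => (m : ZMod q) = a q),
          (liouville m : ℝ)| ≤ C * X / Real.log X ^ A := by
  obtain ⟨Bμ, Cμ, x₀, hBμ, hCμ, hBV⟩ := bombieriVinogradov_moebius (2 * A + 2) (by positivity)
  obtain ⟨Csw, hCsw, hSW⟩ := Polymath8a.sum_moebius_coprime_progression_le_uniform
    SiegelWalfiszMoebius_holds one_pos (B := 2 * A + 10) (by positivity)
  obtain ⟨x₁, hx₁⟩ := Filter.eventually_atTop.1 ((Filter.eventually_ge_atTop x₀).and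
    ((Filter.eventually_ge_atTop (2 : ℝ)).and (Real.tendsto_log_atTop.eventually_ge_atTop (2 : ℝ))))
  refine ⟨max Bμ A, Cμ + Csw + 3, x₁, lt_max_of_lt_left hBμ, by positivity, ?_⟩
  intro X hX Q hQ N hN a ha
  obtain ⟨hXx₀, hX2, hL2⟩ := hx₁ X hX
  have hX0 : 0 < X := by linarith
  set L := Real.log X with hLdef
  have hL1 : 1 ≤ L := by linarith
  have hL0 : 0 < L := by linarith
  have hLp : ∀ e : ℝ, 0 < L ^ e := fun e => Real.rpow_pos_of_pos hL0 e
  have hQμ : (Q : ℝ) ≤ X ^ (1 / 2 : ℝ) / L ^ Bμ := hQ.trans (div_le_div_of_nonneg_left (by positivity)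
    (hLp _) (Real.rpow_le_rpow_of_exponent_le hL1 (le_max_left _ _)))
  have hQA : (Q : ℝ) ≤ X ^ (1 / 2 : ℝ) / L ^ A := hQ.trans (div_le_div_of_nonneg_left (by positivity)
    (hLp _) (Real.rpow_le_rpow_of_exponent_le hL1 (le_max_right _ _)))
  have hQs : (Q : ℝ) ≤ X ^ (1 / 2 : ℝ) :=
    hQA.trans (div_le_self (by positivity) (Real.one_le_rpow hL1 hA.le))
  have hlogQ : 1 + Real.log Q ≤ L := by
    rcases Nat.eq_zero_or_pos Q with rfl | hQ0
    · simp; linarith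
    · have hQ1 : (1 : ℝ) ≤ Q := by exact_mod_cast hQ0
      have h1 : Real.log Q ≤ Real.log (X ^ (1 / 2 : ℝ)) := Real.log_le_log (by linarith) hQs
      rw [Real.log_rpow hX0] at h1
      linarith
  have hlogQ0 : 0 ≤ 1 + Real.log Q := by
    have : 0 ≤ Real.log (Q : ℝ) := Real.log_natCast_nonneg Q; linarith
  have hLA2 : L ^ (A + 2) = L ^ A * L ^ 2 := by
    rw [Real.rpow_add hL0, show (2 : ℝ) = (2 : ℕ) by norm_num, Real.rpow_natCast]
  have hLA1 : L ^ (A + 2) = L ^ (A + 1) * L := by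
    rw [show A + 2 = (A + 1) + 1 by ring, Real.rpow_add hL0, Real.rpow_one]
  have hL2A2 : L ^ (2 * A + 2) = L ^ A * L ^ (A + 2) := by
    rw [← Real.rpow_add hL0]; congr 1; ring
  have hL2A10 : L ^ (2 * A + 10) = L ^ (2 * A + 2) * L ^ 8 := by
    rw [← Real.rpow_natCast L 8, ← Real.rpow_add hL0]; congr 1; push_cast; ring
  set NX := ⌊X⌋₊ with hNXdef
  set S := Nat.sqrt NX with hSdef
  set K₀ := ⌊L ^ (A + 2)⌋₊ with hK₀def
  set Φ : ℕ → ℝ := fun k => ∑ q ∈ Icc 1 Q,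
    |moebiusAPSum (N q / (k * k)) q (sqResidue q (a q) (k * k))| with hΦdef
  have hΦ0 : ∀ k, 0 ≤ Φ k := fun k => sum_nonneg fun _ _ => abs_nonneg _
  have hK₀le : (K₀ : ℝ) ≤ L ^ (A + 2) := Nat.floor_le (hLp _).le
  have hK₀lt : L ^ (A + 2) < K₀ + 1 := Nat.lt_floor_add_one _
  have hK₀1 : 1 ≤ K₀ := Nat.le_floor (by rw [Nat.cast_one]; exact Real.one_le_rpow hL1 (by linarith))
  have hK₀0 : (1 : ℝ) ≤ K₀ := by exact_mod_cast hK₀1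
  have hK₀inv : (1 : ℝ) / K₀ ≤ 2 / L ^ (A + 2) := by
    rw [div_le_div_iff₀ (by linarith) (hLp _)]; linarith
  have hM : ∀ q k, 1 ≤ k → ((N q / (k * k) : ℕ) : ℝ) ≤ X / (k : ℝ) ^ 2 := by
    intro q k hk
    calc ((N q / (k * k) : ℕ) : ℝ) ≤ (N q : ℝ) / ((k * k : ℕ) : ℝ) := Nat.cast_div_le
      _ ≤ X / (k : ℝ) ^ 2 := by
          push_cast; rw [sq]; exact div_le_div_of_nonneg_right (hN q) (by positivity)
  have hNq : ∀ q, N q ≤ NX := fun q => Nat.le_floor (hN q)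
  -- Step 1: `λ = 𝟙_□ ⋆ μ`, swap the sums
  have step1 : ∑ q ∈ Icc 1 Q, |∑ m ∈ (Icc 1 (N q)).filter (fun m : ℕ => (m : ZMod q) = a q),
      (liouville m : ℝ)| ≤ ∑ k ∈ Ioc 0 S, Φ k := by
    calc _ ≤ ∑ q ∈ Icc 1 Q, ∑ k ∈ Ioc 0 S,
          |moebiusAPSum (N q / (k * k)) q (sqResidue q (a q) (k * k))| := by
          refine sum_le_sum fun q hq => (abs_liouvilleAP_le_sum_sq (ha q hq) (N q)).trans ?_
          exact sum_le_sum_of_subset_of_nonneg (Ioc_subset_Ioc_right (Nat.sqrt_le_sqrt (hNq q)))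
            fun _ _ _ => abs_nonneg _
      _ = ∑ k ∈ Ioc 0 S, Φ k := sum_comm
  -- Step 2: small squares, by Bombieri–Vinogradov for `μ` and Siegel–Walfisz for the coprime sums
  have hΦk : ∀ k, Φ k ≤ (Cμ + Csw) * X / L ^ (2 * A + 2) := by
    intro k
    have hdisc : ∑ q ∈ Icc 1 Q, |moebiusDisc (N q / (k * k)) q (sqResidue q (a q) (k * k))| ≤
        Cμ * X / L ^ (2 * A + 2) :=
      hBV X hXx₀ Q hQμ (fun q => N q / (k * k))
        (fun q => le_trans (by exact_mod_cast Nat.div_le_self _ _) (hN q))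
        (fun q => sqResidue q (a q) (k * k)) (fun q hq => isUnit_sqResidue (ha q hq) _)
    have hcop : ∀ q ∈ Icc 1 Q, |moebiusCoprimeSum (N q / (k * k)) q| ≤
        Csw * 4 ^ q.primeFactors.card * X / L ^ (2 * A + 10) := by
      intro q hq
      have hq1 : 1 ≤ q := (mem_Icc.1 hq).1
      rcases Nat.eq_zero_or_pos (N q / (k * k)) with hM0 | hM0
      · rw [hM0]; simp [moebiusCoprimeSum]; positivity
      · have h := hSW X hX2 1 le_rfl (by rw [Nat.cast_one, Real.rpow_one]; exact hL1) (0 : ZMod 1)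
          (isUnit_of_subsingleton _) q (by omega) ((N q / (k * k) : ℕ) : ℝ) (by exact_mod_cast hM0)
          (le_trans (by exact_mod_cast Nat.div_le_self _ _) (hN q))
        have he : ∑ n ∈ (Icc 1 ⌊((N q / (k * k) : ℕ) : ℝ)⌋₊).filter
            (fun n : ℕ => (n : ZMod 1) = 0 ∧ n.Coprime q), (μ n : ℝ) =
            moebiusCoprimeSum (N q / (k * k)) q := by
          rw [Nat.floor_natCast, moebiusCoprimeSum]
          exact sum_congr (filter_congr fun n _ => ⟨fun h => h.2, fun h => ⟨Subsingleton.elim _ _, h⟩⟩)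
            fun _ _ => rfl
        rwa [he] at h
    calc Φ k ≤ ∑ q ∈ Icc 1 Q, (|moebiusDisc (N q / (k * k)) q (sqResidue q (a q) (k * k))| +
          ((Nat.totient q : ℝ))⁻¹ * |moebiusCoprimeSum (N q / (k * k)) q|) :=
          sum_le_sum fun q _ => abs_moebiusAPSum_le_disc _ _ _
      _ ≤ Cμ * X / L ^ (2 * A + 2) + ∑ q ∈ Icc 1 Q, ((Nat.totient q : ℝ))⁻¹ *
            (Csw * 4 ^ q.primeFactors.card * X / L ^ (2 * A + 10)) := by
          rw [sum_add_distrib]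
          exact add_le_add hdisc (sum_le_sum fun q hq =>
            mul_le_mul_of_nonneg_left (hcop q hq) (inv_nonneg.2 (Nat.cast_nonneg _)))
      _ = Cμ * X / L ^ (2 * A + 2) + Csw * X / L ^ (2 * A + 10) *
            ∑ q ∈ Icc 1 Q, (4 : ℝ) ^ q.primeFactors.card / Nat.totient q := by
          rw [mul_sum]
          congr 1
          exact sum_congr rfl fun q _ => by ring
      _ ≤ Cμ * X / L ^ (2 * A + 2) + Csw * X / L ^ (2 * A + 10) * L ^ 8 := by
          gcongr
          exact (sum_four_pow_div_totient_le Q).trans (pow_le_pow_left₀ hlogQ0 hlogQ 8)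
      _ = (Cμ + Csw) * X / L ^ (2 * A + 2) := by
          have h8 : L ^ 8 ≠ 0 := pow_ne_zero 8 hL0.ne'
          rw [hL2A10, ← div_div, div_mul_cancel₀ _ h8]
          ring
  have hmain : ∑ k ∈ Ioc 0 K₀, Φ k ≤ (Cμ + Csw) * X / L ^ A := by
    calc ∑ k ∈ Ioc 0 K₀, Φ k ≤ ∑ _k ∈ Ioc 0 K₀, (Cμ + Csw) * X / L ^ (2 * A + 2) :=
          sum_le_sum fun k _ => hΦk k
      _ = K₀ * ((Cμ + Csw) * X / L ^ (2 * A + 2)) := by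
          rw [sum_const, Nat.card_Ioc, Nat.sub_zero, nsmul_eq_mul]
      _ ≤ L ^ (A + 2) * ((Cμ + Csw) * X / L ^ (2 * A + 2)) :=
          mul_le_mul_of_nonneg_right hK₀le (by positivity)
      _ = (Cμ + Csw) * X / L ^ A := by
          rw [hL2A2]
          have hA2 : L ^ (A + 2) ≠ 0 := (hLp _).ne'
          have hA0 : L ^ A ≠ 0 := (hLp _).ne'
          field_simp
  -- Step 3: large squares, trivially
  have hΦk' : ∀ k, 1 ≤ k → Φ k ≤ X * (1 / (k : ℝ) ^ 2) * L + Q := by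
    intro k hk
    calc Φ k ≤ ∑ q ∈ Icc 1 Q, (((N q / (k * k) : ℕ) : ℝ) / q + 1) :=
          sum_le_sum fun q _ => abs_moebiusAPSum_le _ _ _
      _ ≤ ∑ q ∈ Icc 1 Q, (X / (k : ℝ) ^ 2 * ((q : ℝ))⁻¹ + 1) := by
          refine sum_le_sum fun q _ => ?_
          rw [div_eq_mul_inv]
          gcongr
          exact hM q k hk
      _ = X / (k : ℝ) ^ 2 * ∑ q ∈ Icc 1 Q, ((q : ℝ))⁻¹ + Q := by
          rw [sum_add_distrib, ← mul_sum, sum_const, Nat.card_Icc, Nat.add_sub_cancel, nsmul_eq_mul,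
            mul_one]
      _ ≤ X / (k : ℝ) ^ 2 * L + Q := by
          gcongr
          exact (harmonic_Icc_le Q).trans hlogQ
      _ = X * (1 / (k : ℝ) ^ 2) * L + Q := by ring
  have hS : (S : ℝ) ≤ X ^ (1 / 2 : ℝ) := by
    have hSS : ((S * S : ℕ) : ℝ) ≤ NX := by exact_mod_cast Nat.sqrt_le NX
    push_cast at hSS
    have hS2 : (S : ℝ) ^ 2 ≤ X := by
      calc (S : ℝ) ^ 2 = (S : ℝ) * S := sq _
        _ ≤ NX := hSS
        _ ≤ X := Nat.floor_le hX0.le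
    rw [← Real.sqrt_eq_rpow]
    calc (S : ℝ) = Real.sqrt ((S : ℝ) ^ 2) := (Real.sqrt_sq (Nat.cast_nonneg S)).symm
      _ ≤ Real.sqrt X := Real.sqrt_le_sqrt hS2
  have htail : ∑ k ∈ Ioc K₀ S, Φ k ≤ 3 * X / L ^ A := by
    calc ∑ k ∈ Ioc K₀ S, Φ k ≤ ∑ k ∈ Ioc K₀ S, (X * (1 / (k : ℝ) ^ 2) * L + Q) :=
          sum_le_sum fun k hk => hΦk' k (by have := (mem_Ioc.1 hk).1; omega)
      _ = X * L * ∑ k ∈ Ioc K₀ S, (1 / (k : ℝ) ^ 2) + #(Ioc K₀ S) * (Q : ℝ) := by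
          rw [sum_add_distrib, sum_const, nsmul_eq_mul, mul_sum]
          congr 1
          exact sum_congr rfl fun k _ => by ring
      _ ≤ X * L * (1 / K₀) + S * (Q : ℝ) := by
          gcongr
          · exact sum_Ioc_inv_sq_le hK₀1 S
          · rw [Nat.card_Ioc]; exact_mod_cast Nat.sub_le S K₀
      _ ≤ X * L * (2 / L ^ (A + 2)) + X ^ (1 / 2 : ℝ) * (X ^ (1 / 2 : ℝ) / L ^ A) := by
          gcongr
      _ = 2 * X / L ^ (A + 1) + X / L ^ A := by
          congr 1
          · rw [hLA1]
            have hA1 : L ^ (A + 1) ≠ 0 := (hLp _).ne'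
            field_simp
          · rw [← mul_div_assoc, ← Real.rpow_add hX0]; norm_num
      _ ≤ 2 * X / L ^ A + X / L ^ A := by
          gcongr ?_ + _
          exact div_le_div_of_nonneg_left (by positivity) (hLp A)
            (Real.rpow_le_rpow_of_exponent_le hL1 (by linarith))
      _ = 3 * X / L ^ A := by ring
  have hsplit : ∑ k ∈ Ioc 0 S, Φ k ≤ ∑ k ∈ Ioc 0 K₀, Φ k + ∑ k ∈ Ioc K₀ S, Φ k := by
    rcases le_or_gt K₀ S with h | h
    · rw [← sum_Ioc_consecutive Φ (Nat.zero_le K₀) h]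
    · have he : Ioc K₀ S = ∅ := Finset.Ioc_eq_empty (by omega)
      rw [he, sum_empty, add_zero]
      exact sum_le_sum_of_subset_of_nonneg (Ioc_subset_Ioc_right h.le) fun k _ _ => hΦ0 k
  calc _ ≤ ∑ k ∈ Ioc 0 S, Φ k := step1
    _ ≤ (Cμ + Csw) * X / L ^ A + 3 * X / L ^ A := hsplit.trans (add_le_add hmain htail)
    _ = (Cμ + Csw + 3) * X / L ^ A := by ring

/-! ### From `λ(dn + c)` to a `λ`-sum over a reduced residue class -/

/-- `|∑_{n ≤ N} λ(qn + b)| ≤ |∑_{m ≤ qN + b, m ≡ b (q)} λ(m)| + 1` for `b < q`: the progression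
`{qn + b : 1 ≤ n ≤ N}` is the class `b (mod q)` in `(b, qN + b]`, and `[1, b]` meets the class in at
most one point. [folklore] -/
theorem abs_sum_liouville_linear_le {q b : ℕ} (hb : b < q) (N : ℕ) :
    |∑ n ∈ Icc 1 N, (liouville (q * n + b) : ℝ)| ≤
      |∑ m ∈ (Icc 1 (q * N + b)).filter (fun m : ℕ => (m : ZMod q) = (b : ZMod q)),
        (liouville m : ℝ)| + 1 := by
  have hq : 0 < q := by omega
  have hsplit : ∑ m ∈ (Icc 1 (q * N + b)).filter (fun m : ℕ => (m : ZMod q) = (b : ZMod q)),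
      (liouville m : ℝ) =
      ∑ m ∈ (Icc 1 b).filter (fun m : ℕ => (m : ZMod q) = (b : ZMod q)), (liouville m : ℝ) +
      ∑ m ∈ (Ioc b (q * N + b)).filter (fun m : ℕ => (m : ZMod q) = (b : ZMod q)),
        (liouville m : ℝ) := by
    rw [sum_filter, sum_filter, sum_filter, show Icc 1 (q * N + b) = Ioc 0 (q * N + b) from rfl,
      show (Icc 1 b : Finset ℕ) = Ioc 0 b from rfl]
    exact (sum_Ioc_consecutive _ (Nat.zero_le b) (Nat.le_add_left b _)).symm
  have himage : (Ioc b (q * N + b)).filter (fun m : ℕ => (m : ZMod q) = (b : ZMod q)) =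
      (Icc 1 N).image (fun n => q * n + b) := by
    ext m
    simp only [mem_filter, mem_Ioc, mem_image, mem_Icc]
    constructor
    · rintro ⟨⟨hbm, hmM⟩, hPm⟩
      have hmod : m % q = b := by
        have := (ZMod.natCast_eq_natCast_iff' m b q).1 hPm
        rwa [Nat.mod_eq_of_lt hb] at this
      have hdm := Nat.div_add_mod m q
      rw [hmod] at hdm
      refine ⟨m / q, ⟨?_, ?_⟩, hdm⟩
      · refine Nat.pos_of_ne_zero fun h00 => ?_
        rw [h00, mul_zero, zero_add] at hdm
        omega
      · by_contra h0
        have h1 : N + 1 ≤ m / q := Nat.lt_of_not_le h0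
        have h2 := Nat.mul_le_mul_left q h1
        rw [Nat.mul_succ] at h2
        omega
    · rintro ⟨n, ⟨hn1, hnN⟩, rfl⟩
      refine ⟨⟨?_, ?_⟩, ?_⟩
      · have : 0 < q * n := Nat.mul_pos hq hn1
        omega
      · have := Nat.mul_le_mul_left q hnN
        omega
      · push_cast
        rw [ZMod.natCast_self, zero_mul, zero_add]
  have hsum2 : ∑ m ∈ (Ioc b (q * N + b)).filter (fun m : ℕ => (m : ZMod q) = (b : ZMod q)),
      (liouville m : ℝ) = ∑ n ∈ Icc 1 N, (liouville (q * n + b) : ℝ) := by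
    rw [himage, sum_image]
    intro n₁ _ n₂ _ h
    exact Nat.eq_of_mul_eq_mul_left hq (by simpa using h)
  have hsmall : |∑ m ∈ (Icc 1 b).filter (fun m : ℕ => (m : ZMod q) = (b : ZMod q)),
      (liouville m : ℝ)| ≤ 1 := by
    refine (abs_sum_le_sum_abs _ _).trans ?_
    calc ∑ m ∈ (Icc 1 b).filter (fun m : ℕ => (m : ZMod q) = (b : ZMod q)), |(liouville m : ℝ)|
        ≤ ∑ _m ∈ (Icc 1 b).filter (fun m : ℕ => (m : ZMod q) = (b : ZMod q)), (1 : ℝ) :=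
          sum_le_sum fun m _ => abs_liouville_le_one m
      _ = #((Icc 1 b).filter (fun m : ℕ => (m : ZMod q) = (b : ZMod q))) := by simp
      _ ≤ ((b / q + 1 : ℕ) : ℝ) := by exact_mod_cast card_filter_natCast_eq_le (b : ZMod q) b
      _ = 1 := by rw [Nat.div_eq_of_lt hb]; simp
  rw [hsplit, hsum2]
  calc |∑ n ∈ Icc 1 N, (liouville (q * n + b) : ℝ)|
      = |(∑ m ∈ (Icc 1 b).filter (fun m : ℕ => (m : ZMod q) = (b : ZMod q)), (liouville m : ℝ) +
          ∑ n ∈ Icc 1 N, (liouville (q * n + b) : ℝ)) -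
          ∑ m ∈ (Icc 1 b).filter (fun m : ℕ => (m : ZMod q) = (b : ZMod q)), (liouville m : ℝ)| := by
        rw [add_sub_cancel_left]
    _ ≤ _ := abs_sub _ _
    _ ≤ _ := by linarith [hsmall]

/-- Complete multiplicativity: with `g = (c, d)` (`c ≥ 0`),
`|∑_{n ≤ N} λ(dn + c)| ≤ |∑_{n ≤ N} λ((d/g)n + c/g)|` (`λ(gm) = λ(g)λ(m)`, `|λ(g)| ≤ 1`). [folklore] -/
theorem abs_sum_liouville_toNat_le {d : ℕ} {c : ℤ} (hc : 0 ≤ c) (N : ℕ) :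
    |∑ n ∈ Icc 1 N, (liouville (Int.toNat ((d : ℤ) * n + c)) : ℝ)| ≤
      |∑ n ∈ Icc 1 N, (liouville (d / Nat.gcd c.toNat d * n + c.toNat / Nat.gcd c.toNat d) : ℝ)| := by
  set g := Nat.gcd c.toNat d with hg
  have hd : g ∣ d := Nat.gcd_dvd_right _ _
  have hcg : g ∣ c.toNat := Nat.gcd_dvd_left _ _
  have hterm : ∀ n : ℕ, Int.toNat ((d : ℤ) * n + c) = g * (d / g * n + c.toNat / g) := by
    intro n
    have h1 : (d : ℤ) * n + c = ((d * n + c.toNat : ℕ) : ℤ) := by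
      rw [Nat.cast_add, Nat.cast_mul, Int.toNat_of_nonneg hc]
    rw [h1, Int.toNat_natCast, mul_add, ← mul_assoc, Nat.mul_div_cancel' hd, Nat.mul_div_cancel' hcg]
  simp_rw [hterm, liouville_apply_mul, Int.cast_mul, ← mul_sum, abs_mul]
  exact mul_le_of_le_one_left (abs_nonneg _) (abs_liouville_le_one g)

/-- `c/g < d/g` for `0 ≤ c < d`, `g = (c, d)`. [folklore] -/
theorem toNat_div_lt {d g : ℕ} (hd : 1 ≤ d) {c : ℤ} (hcd : c < d) (hg : Nat.gcd c.toNat d = g) :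
    c.toNat / g < d / g := by
  have hcn : c.toNat < d := (Int.toNat_lt' (by omega)).2 hcd
  refine Nat.lt_of_mul_lt_mul_left (a := g) ?_
  rwa [Nat.mul_div_cancel' (hg ▸ Nat.gcd_dvd_left _ _), Nat.mul_div_cancel' (hg ▸ Nat.gcd_dvd_right _ _)]

/-- The term of a Bombieri–Vinogradov sum for `λ` with an arbitrary residue, at a modulus `d` with residue `0 ≤ c < d`, `g = (c, d)`, is at most the
`λ`-sum over the reduced class `c/g (mod d/g)` up to the height `(d/g)⌊y/d⌋ + c/g`, plus `1`. [folklore] -/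
theorem term_le {d g : ℕ} (hd : 1 ≤ d) {c : ℤ} (hc0 : 0 ≤ c) (hcd : c < d)
    (hg : Nat.gcd c.toNat d = g) (y : ℝ) :
    |∑ n ∈ Icc 1 ⌊y / d⌋₊, (liouville (Int.toNat ((d : ℤ) * n + c)) : ℝ)| ≤
      |∑ m ∈ (Icc 1 (d / g * ⌊y / d⌋₊ + c.toNat / g)).filter
          (fun m : ℕ => (m : ZMod (d / g)) = ((c.toNat / g : ℕ) : ZMod (d / g))),
        (liouville m : ℝ)| + 1 := by
  have h1 := abs_sum_liouville_toNat_le (d := d) hc0 ⌊y / d⌋₊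
  rw [hg] at h1
  exact h1.trans (abs_sum_liouville_linear_le (toNat_div_lt hd hcd hg) _)

end Literature.NumberTheory.Sieve.BVLiouvilleHeights

end
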